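import Summits.KontsevichZagierPeriods.KontsevichZagierPeriods.Theorems.XMapKernel.Negative.Core
import Summits.KontsevichZagierPeriods.KontsevichZagierPeriods.Theorems.XMapPeriodTransfer.Negative.ValueSide

/-!
# `XMapKernel` (stmt-KontsevichZagierPeriods-10663, route IsogenyCertificates) — line
`isogeny-orbit-collapse`, stub `stub_cellCollapse` (C, the lever of the line)

**Cell collapse.** Work in the quotient `Q := FormalRep ⧸ closure gens` of the formal group of integral
representations by the crux's enlarged move group (`gens` = the four KZ moves ∪ the x-map period relators,
`Summit.KontsevichZagierPeriods.XMapKernel.Negative.gens`). Given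

* (S) honest representations `R(A,B,a) = [{P>0}, a/√P]` for every nonsingular integral `(A,B)` and every
  `a ∈ ℚ`,
* (V) ORBIT COLLAPSE: along an x-rational isogeny datum `(A,B) → (A',B')` the full real periods
  `Ω(A,B) = ∫_{P>0} dx/√P` satisfy `Ω(A,B) = q·Ω(A',B')` with `q ∈ ℚ_{>0}`,
* (RPI) REAL-PERIOD INDEPENDENCE: the full real periods of pairwise datum-unrelated nonsingular integral
  cubics are `ℚ`-linearly independent,

every element of the closure of the sector generators `[{P>0}, a/√P]` (`a ∈ ℚ`) with value `0` lies in
`closure gens`. Proof: (1) `a ↦ [R(A,B,a)]` is ADDITIVE into `Q` (rule (1b): `R(a+b) − R(a) − R(b)` is an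
integrand-additivity move), so every element of the sector closure is, in `Q`, `∑_p ψ_p(a_p)` for a finitely
supported coefficient vector `a : ℤ × ℤ →₀ ℚ` on nonsingular curves, with value `∑_p a_p Ω(p)`
(`AddSubgroup.closure_induction`); (2) if two distinct curves `p ≠ p'` of the support are joined by a datum,
the relator `[R(p,t)] − [R(p', t q)]` (`t > 0`, `q` from (V); value equality is exactly (V)) identifies
`ψ_p(t) = ψ_{p'}(t q)` for `t > 0`, hence for all `t` by additivity, so the `p`-term can be moved onto `p'`
without changing the class in `Q` nor the value — the support shrinks; (3) when the support is pairwise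
unrelated, (RPI) forces all coefficients to vanish, so the support is empty. Induction on the size of the
support. No move other than (1b) and the relators is used (Disproof F4c honoured; F4b located off the cell).

References: Kontsevich–Zagier 2001 §1.2; Huber–Wüstholz 2022 Thm 15.3 (enters only through (RPI)).
-/

noncomputable section

namespace Summit.KontsevichZagierPeriods.IsogenyCertificates.XMapKernelStubs.CellCollapse

open scoped BigOperators
open Set MeasureTheory
open Literature.NumberTheory.Transcendental
open Summit.KontsevichZagierPeriods.XMapKernel.Negative
open Summit.KontsevichZagierPeriods.IsogenyCertificates.XMapPeriodTransferValue

/-- Rule (1b) for three representations on a common domain whose integrands are literally `t/√P`, `t₁/√P`,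
`t₂/√P` with `t = t₁ + t₂`: `[r] − [r₁] − [r₂]` is an integrand-additivity move, hence a relation.
[cite: KontsevichZagier2001, §1.2 rule (1)] -/
theorem sub_sub_mem_relations_of_integrand {A B : ℤ} {t t₁ t₂ : ℚ} (ht : t = t₁ + t₂)
    (r r₁ r₂ : KZ.IntegralRep 1)
    (hd : r.domain = {x | 0 < x 0 ^ 3 + (A : ℝ) * x 0 + (B : ℝ)})
    (hd₁ : r₁.domain = {x | 0 < x 0 ^ 3 + (A : ℝ) * x 0 + (B : ℝ)})
    (hd₂ : r₂.domain = {x | 0 < x 0 ^ 3 + (A : ℝ) * x 0 + (B : ℝ)})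
    (hi : r.integrand = fun x => (t : ℝ) / Real.sqrt (x 0 ^ 3 + (A : ℝ) * x 0 + (B : ℝ)))
    (hi₁ : r₁.integrand = fun x => (t₁ : ℝ) / Real.sqrt (x 0 ^ 3 + (A : ℝ) * x 0 + (B : ℝ)))
    (hi₂ : r₂.integrand = fun x => (t₂ : ℝ) / Real.sqrt (x 0 ^ 3 + (A : ℝ) * x 0 + (B : ℝ))) :
    KZ.of r - KZ.of r₁ - KZ.of r₂ ∈ KZ.relations := by
  refine KZ.integrandAddRel_subset_relations ⟨1, r, r₁, r₂, by rw [hd₁, hd], by rw [hd₂, hd], ?_, rfl⟩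
  intro x _
  simp only [hi, hi₁, hi₂, Pi.add_apply, ht, Rat.cast_add]
  ring

/-- The value of a representation with the sector's literal domain and integrand `t/√P` is `t·Ω(A,B)`,
`Ω(A,B) = ∫_{P>0} dx/√P`. [cite: KontsevichZagier2001, §1.1] -/
theorem value_of_integrand {A B : ℤ} {t : ℚ} (r : KZ.IntegralRep 1)
    (hd : r.domain = {x | 0 < x 0 ^ 3 + (A : ℝ) * x 0 + (B : ℝ)})
    (hi : r.integrand = fun x => (t : ℝ) / Real.sqrt (x 0 ^ 3 + (A : ℝ) * x 0 + (B : ℝ))) :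
    r.value = (t : ℝ) * ∫ x in {x : Fin 1 → ℝ | 0 < x 0 ^ 3 + (A : ℝ) * x 0 + (B : ℝ)},
      1 / Real.sqrt (x 0 ^ 3 + (A : ℝ) * x 0 + (B : ℝ)) :=
  value_eq r hd (by rw [hi]; exact fun x _ => rfl)

/-- **Stub C of line isogeny-orbit-collapse (cell collapse).** Sector representations exist, orbit collapse
and real-period independence imply: every element of the closure of the real-period sector generators with
value `0` lies in the closure of the crux's generating set `gens` (moves ∪ x-map relators). See the module
docstring for the proof. [cite: KontsevichZagier2001, §1.2] -/
theorem stub_cellCollapse : (∀ (A B : ℤ) (a : ℚ), 4 * A ^ 3 + 27 * B ^ 2 ≠ 0 → ∃ r : Literature.NumberTheory.Transcendental.KZ.IntegralRep 1, r.domain = {x | 0 < x 0 ^ 3 + (A : ℝ) * x 0 + (B : ℝ)} ∧ r.integrand = fun x => (a : ℝ) / Real.sqrt (x 0 ^ 3 + (A : ℝ) * x 0 + (B : ℝ))) → (∀ (A B A' B' : ℤ), 4 * A ^ 3 + 27 * B ^ 2 ≠ 0 → 4 * A' ^ 3 + 27 * B' ^ 2 ≠ 0 → (∃ (f g : Polynomial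 ℚ) (c : ℚ), Polynomial.derivative f * g - f * Polynomial.derivative g ≠ 0 ∧ Polynomial.C (c ^ 2) * g * (f ^ 3 + Polynomial.C (A' : ℚ) * f * g ^ 2 + Polynomial.C (B' : ℚ) * g ^ 3) = (Polynomial.X ^ 3 + Polynomial.C (A : ℚ) * Polynomial.X + Polynomial.C (B : ℚ)) * (Polynomial.derivative f * g - f * Polynomial.derivative g) ^ 2) → ∃ q : ℚ, 0 < q ∧ (∫ x in {x : Fin 1 → ℝ | 0 < x 0 ^ 3 + (A : ℝ) * x 0 + (B : ℝ)}, 1 / Real.sqrt (x 0 ^ 3 + (A : ℝ) * x 0 + (B : ℝ))) = (q : ℝ) * ∫ x in {x : Fin 1 → ℝ | 0 < x 0 ^ 3 + (A' : ℝ) * x 0 + (B' : ℝ)}, 1 / Real.sqrt (x 0 ^ 3 + (A' : ℝ) * x 0 + (B' : ℝ))) → (∀ (k : ℕ) (A B : Fin k → ℤ) (q : Fin k → ℚ), (∀ i, 4 * A i ^ 3 + 27 * B i ^ 2 ≠ 0) → (∀ i j, i ≠ j → ¬ ∃ (f g : Polynomial ℚ) (c : ℚ), Polynomial.derivative f * g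 - f * Polynomial.derivative g ≠ 0 ∧ Polynomial.C (c ^ 2) * g * (f ^ 3 + Polynomial.C (A j : ℚ) * f * g ^ 2 + Polynomial.C (B j : ℚ) * g ^ 3) = (Polynomial.X ^ 3 + Polynomial.C (A i : ℚ) * Polynomial.X + Polynomial.C (B i : ℚ)) * (Polynomial.derivative f * g - f * Polynomial.derivative g) ^ 2) → ∑ i, (q i : ℝ) * (∫ x in {x : Fin 1 → ℝ | 0 < x 0 ^ 3 + (A i : ℝ) * x 0 + (B i : ℝ)}, 1 / Real.sqrt (x 0 ^ 3 + (A i : ℝ) * x 0 + (B i : ℝ))) = 0 → ∀ i, q i = 0) → ∀ c ∈ AddSubgroup.closure {d : Literature.NumberTheory.Transcendental.KZ.FormalRep | ∃ (A B : ℤ) (a : ℚ) (r : Literature.NumberTheory.Transcendental.KZ.IntegralRep 1), 4 * A ^ 3 + 27 * B ^ 2 ≠ 0 ∧ r.domain = {x | 0 < x 0 ^ 3 + (A : ℝ) * x 0 + (B : ℝ)} ∧ Set.EqOn r.integrand (fun x => (a : ℝ) / Real.sqrt (x 0 ^ 3 + (A : ℝ) * x 0 + (B : ℝ))) r.domain ∧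 d = Literature.NumberTheory.Transcendental.KZ.of r}, Literature.NumberTheory.Transcendental.KZ.eval c = 0 → c ∈ AddSubgroup.closure Summit.KontsevichZagierPeriods.XMapKernel.Negative.gens := by
  intro hS hV hI c hc hc0
  classical
  -- (S): canonical representations
  choose R hRd hRi using hS
  -- the full real period of the curve `p = (A, B)`
  let ω : ℤ × ℤ → ℝ := fun p => ∫ x in {x : Fin 1 → ℝ | 0 < x 0 ^ 3 + (p.1 : ℝ) * x 0 + (p.2 : ℝ)},
    1 / Real.sqrt (x 0 ^ 3 + (p.1 : ℝ) * x 0 + (p.2 : ℝ))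
  -- the quotient by the enlarged move group
  set G : AddSubgroup KZ.FormalRep := AddSubgroup.closure gens with hG
  let π : KZ.FormalRep →+ KZ.FormalRep ⧸ G := QuotientAddGroup.mk' G
  have hπ : ∀ x, π x = 0 ↔ x ∈ G := fun x => QuotientAddGroup.eq_zero_iff x
  have hrelG : ∀ {x}, x ∈ KZ.relations → π x = 0 := fun hx => (hπ _).2 (relations_le_closure_gens hx)
  -- additivity of `t ↦ [R(p,t)]` modulo relations
  have hadd : ∀ (p : ℤ × ℤ) (h : 4 * p.1 ^ 3 + 27 * p.2 ^ 2 ≠ 0) (t₁ t₂ : ℚ),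
      π (KZ.of (R p.1 p.2 (t₁ + t₂) h)) = π (KZ.of (R p.1 p.2 t₁ h)) + π (KZ.of (R p.1 p.2 t₂ h)) := by
    intro p h t₁ t₂
    have hmem := sub_sub_mem_relations_of_integrand rfl (R p.1 p.2 (t₁ + t₂) h) (R p.1 p.2 t₁ h)
      (R p.1 p.2 t₂ h) (hRd _ _ _ h) (hRd _ _ _ h) (hRd _ _ _ h) (hRi _ _ _ h) (hRi _ _ _ h) (hRi _ _ _ h)
    have h0 := hrelG hmem
    rw [map_sub, map_sub] at h0
    -- h0 : π a - π b - π c = 0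
    have := sub_eq_zero.1 h0
    rw [sub_eq_iff_eq_add] at this
    rw [this, add_comm]
  -- the per-curve homomorphisms `ψ p : ℚ →+ Q`
  let ψ : ℤ × ℤ → (ℚ →+ KZ.FormalRep ⧸ G) := fun p =>
    if h : 4 * p.1 ^ 3 + 27 * p.2 ^ 2 ≠ 0 then
      AddMonoidHom.mk' (fun t => π (KZ.of (R p.1 p.2 t h))) (fun t₁ t₂ => hadd p h t₁ t₂)
    else 0
  have hψ : ∀ (p : ℤ × ℤ) (h : 4 * p.1 ^ 3 + 27 * p.2 ^ 2 ≠ 0) (t : ℚ),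
      ψ p t = π (KZ.of (R p.1 p.2 t h)) := by
    intro p h t
    simp only [ψ, dif_pos h, AddMonoidHom.mk'_apply]
  -- linear extensions to finitely supported coefficient vectors
  let Ψ : (ℤ × ℤ →₀ ℚ) →+ KZ.FormalRep ⧸ G := Finsupp.liftAddHom ψ
  let φ : ℤ × ℤ → (ℚ →+ ℝ) := fun p =>
    (AddMonoidHom.mulRight (ω p)).comp (Rat.castHom ℝ : ℚ →+* ℝ).toAddMonoidHom
  let E : (ℤ × ℤ →₀ ℚ) →+ ℝ := Finsupp.liftAddHom φ
  have hΨ1 : ∀ p t, Ψ (Finsupp.single p t) = ψ p t := fun p t => Finsupp.liftAddHom_apply_single ψ p t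
  have hE1 : ∀ p t, E (Finsupp.single p t) = (t : ℝ) * ω p := fun p t => by
    simp only [E, Finsupp.liftAddHom_apply_single, φ, AddMonoidHom.coe_comp, Function.comp_apply,
      RingHom.toAddMonoidHom_eq_coe, AddMonoidHom.coe_coe, Rat.coe_castHom, AddMonoidHom.coe_mulRight]
  have hEsum : ∀ a : ℤ × ℤ →₀ ℚ, E a = ∑ p ∈ a.support, (a p : ℝ) * ω p := fun a => by
    simp only [E, Finsupp.liftAddHom_apply, Finsupp.sum, φ, AddMonoidHom.coe_comp, Function.comp_apply,
      RingHom.toAddMonoidHom_eq_coe, AddMonoidHom.coe_coe, Rat.coe_castHom, AddMonoidHom.coe_mulRight]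
  -- STEP A: normal form of the sector closure in `Q`, with its value
  have stepA : ∀ x ∈ AddSubgroup.closure {d : KZ.FormalRep | ∃ (A B : ℤ) (a : ℚ) (r : KZ.IntegralRep 1),
      4 * A ^ 3 + 27 * B ^ 2 ≠ 0 ∧ r.domain = {x | 0 < x 0 ^ 3 + (A : ℝ) * x 0 + (B : ℝ)} ∧
      Set.EqOn r.integrand (fun x => (a : ℝ) / Real.sqrt (x 0 ^ 3 + (A : ℝ) * x 0 + (B : ℝ))) r.domain ∧
      d = KZ.of r},
      ∃ a : ℤ × ℤ →₀ ℚ, (∀ p ∈ a.support, 4 * p.1 ^ 3 + 27 * p.2 ^ 2 ≠ 0) ∧ π x = Ψ a ∧ KZ.eval x = E a := by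
    intro x hx
    induction hx using AddSubgroup.closure_induction with
    | mem x hx =>
      obtain ⟨A, B, t, r, hns, hd, he, rfl⟩ := hx
      refine ⟨Finsupp.single (A, B) t, fun p hp => ?_, ?_, ?_⟩
      · have := Finsupp.support_single_subset hp
        rw [Finset.mem_singleton] at this
        rw [this]
        exact hns
      · -- `[r] = [R(A,B,t)]` in `Q`: same domain, integrands agree on it
        rw [hΨ1, hψ (A, B) hns]
        have heq : KZ.Equivalent r (R A B t hns) :=
          equivalent_of_eqOn r (R A B t hns) (by rw [hRd, hd]) (by rw [hRi]; exact he)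
        have h0 := hrelG heq
        rw [map_sub, sub_eq_zero] at h0
        exact h0
      · rw [hE1, KZ.eval_of]
        exact value_eq r hd he
    | zero => exact ⟨0, by simp, by simp, by simp⟩
    | add x y _ _ ihx ihy =>
      obtain ⟨a, ha, hπa, hEa⟩ := ihx
      obtain ⟨b, hb, hπb, hEb⟩ := ihy
      refine ⟨a + b, fun p hp => ?_, by rw [map_add, map_add, hπa, hπb], by rw [map_add, map_add, hEa, hEb]⟩
      rcases Finset.mem_union.1 (Finsupp.support_add hp) with h | h
      · exact ha p h
      · exact hb p h
    | neg x _ ih =>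
      obtain ⟨a, ha, hπa, hEa⟩ := ih
      exact ⟨-a, fun p hp => ha p (by rwa [Finsupp.support_neg] at hp), by rw [map_neg, map_neg, hπa],
        by rw [map_neg, map_neg, hEa]⟩
  -- STEP B: collapse along data, induction on the size of the support
  have stepB : ∀ (n : ℕ) (a : ℤ × ℤ →₀ ℚ), a.support.card ≤ n →
      (∀ p ∈ a.support, 4 * p.1 ^ 3 + 27 * p.2 ^ 2 ≠ 0) → E a = 0 → Ψ a = 0 := by
    intro n
    induction n with
    | zero =>
      intro a hcard _ _
      have ha : a = 0 := by
        rwa [Nat.le_zero, Finset.card_eq_zero, Finsupp.support_eq_empty] at hcard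
      rw [ha, map_zero]
    | succ n ih =>
      intro a hcard hns hEa
      by_cases hrel : ∃ p ∈ a.support, ∃ p' ∈ a.support, p ≠ p' ∧ ∃ (f g : Polynomial ℚ) (c : ℚ),
          Polynomial.derivative f * g - f * Polynomial.derivative g ≠ 0 ∧
          Polynomial.C (c ^ 2) * g * (f ^ 3 + Polynomial.C (p'.1 : ℚ) * f * g ^ 2 + Polynomial.C (p'.2 : ℚ) * g ^ 3) =
            (Polynomial.X ^ 3 + Polynomial.C (p.1 : ℚ) * Polynomial.X + Polynomial.C (p.2 : ℚ)) *
              (Polynomial.derivative f * g - f * Polynomial.derivative g) ^ 2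
      · -- collapse the curve `p` onto `p'`
        obtain ⟨p, hp, p', hp', hpp', f, g, c₀, hW, hId⟩ := hrel
        have hnp := hns p hp
        have hnp' := hns p' hp'
        obtain ⟨qr, hq0, hΩ⟩ := hV p.1 p.2 p'.1 p'.2 hnp hnp' ⟨f, g, c₀, hW, hId⟩
        -- `hΩ : ω p = qr * ω p'`
        have hΩ' : ω p = (qr : ℝ) * ω p' := hΩ
        -- the relator identifies `ψ p t` with `ψ p' (t * qr)` for `t > 0` …
        have hpos : ∀ t : ℚ, 0 < t → ψ p t = ψ p' (t * qr) := by
          intro t ht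
          rw [hψ p hnp, hψ p' hnp', ← sub_eq_zero, ← map_sub, hπ, hG]
          refine AddSubgroup.subset_closure (Or.inr ?_)
          refine ⟨p.1, p.2, p'.1, p'.2, f, g, c₀, t, t * qr, R p.1 p.2 t hnp, R p'.1 p'.2 (t * qr) hnp',
            hnp, hnp', hW, hId, ht, mul_pos ht hq0, hRd _ _ _ hnp, ?_, hRd _ _ _ hnp', ?_, ?_, rfl⟩
          · rw [hRi]; exact fun x _ => rfl
          · rw [hRi]; exact fun x _ => rfl
          · rw [value_of_integrand (R p.1 p.2 t hnp) (hRd _ _ _ hnp) (hRi _ _ _ hnp),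
              value_of_integrand (R p'.1 p'.2 (t * qr) hnp') (hRd _ _ _ hnp') (hRi _ _ _ hnp')]
            change (t : ℝ) * ω p = ((t * qr : ℚ) : ℝ) * ω p'
            rw [hΩ', Rat.cast_mul]
            ring
        -- … hence for all `t`, by additivity
        have key : ∀ t : ℚ, ψ p t = ψ p' (t * qr) := by
          intro t
          have h1 := hpos (|t| + 1) (by positivity)
          have h2 := hpos (t + (|t| + 1)) (by have := neg_abs_le t; linarith)
          have e1 : ψ p t = ψ p (t + (|t| + 1)) - ψ p (|t| + 1) := by rw [map_add]; abel
          rw [e1, h1, h2, ← map_sub]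
          congr 1
          ring
        -- move the `p`-coefficient onto `p'`
        set a' : ℤ × ℤ →₀ ℚ := a - Finsupp.single p (a p) + Finsupp.single p' (a p * qr) with ha'
        have hΨ' : Ψ a' = Ψ a := by
          rw [ha', map_add, map_sub, hΨ1, hΨ1, key (a p)]
          abel
        have hE' : E a' = 0 := by
          rw [ha', map_add, map_sub, hE1, hE1, hEa, hΩ', Rat.cast_mul]
          ring
        have hsupp' : a'.support ⊆ a.support.erase p := by
          intro x hx
          rw [Finsupp.mem_support_iff] at hx
          rw [Finset.mem_erase]
          have hx' : a' x = a x - (Finsupp.single p (a p)) x + (Finsupp.single p' (a p * qr)) x := by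
            rw [ha']
            simp only [Finsupp.coe_add, Finsupp.coe_sub, Pi.add_apply, Pi.sub_apply]
          rw [hx', Finsupp.single_apply, Finsupp.single_apply] at hx
          by_cases hxp : x = p
          · exfalso
            rw [if_pos hxp.symm, if_neg (fun h : p' = x => hpp' (h.trans hxp).symm), hxp] at hx
            exact hx (by ring)
          · refine ⟨hxp, ?_⟩
            rw [Finsupp.mem_support_iff]
            intro hax
            rw [hax, if_neg (fun h : p = x => hxp h.symm)] at hx
            by_cases hxp' : x = p'
            · rw [hxp'] at hax
              exact (Finsupp.mem_support_iff.1 hp') hax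
            · rw [if_neg (fun h : p' = x => hxp' h.symm)] at hx
              exact hx (by ring)
        have hcard' : a'.support.card ≤ n := by
          have h1 := Finset.card_le_card hsupp'
          rw [Finset.card_erase_of_mem hp] at h1
          omega
        have hns' : ∀ x ∈ a'.support, 4 * x.1 ^ 3 + 27 * x.2 ^ 2 ≠ 0 :=
          fun x hx => hns x (Finset.mem_of_mem_erase (hsupp' hx))
        rw [← hΨ']
        exact ih a' hcard' hns' hE'
      · -- pairwise unrelated support: (RPI) kills every coefficient, so the support is empty
        push Not at hrel
        set k : ℕ := a.support.card with hk
        let e : Fin k ≃ {x // x ∈ a.support} := a.support.equivFin.symm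
        have hzero := hI k (fun i => (e i).1.1) (fun i => (e i).1.2) (fun i => a (e i).1)
          (fun i => hns _ (e i).2) ?_ ?_
        · -- every coefficient on the support vanishes: the support is empty
          have hk0 : k = 0 := by
            by_contra hk0
            have i : Fin k := ⟨0, Nat.pos_of_ne_zero hk0⟩
            exact (Finsupp.mem_support_iff.1 (e i).2) (hzero i)
          have ha0 : a = 0 := by
            rw [← Finsupp.support_eq_empty, ← Finset.card_eq_zero]
            exact hk0
          rw [ha0, map_zero]
        · intro i j hij
          have hne : (e i).1 ≠ (e j).1 := fun h => hij (e.injective (Subtype.ext h))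
          rintro ⟨f, g, c₀, hW, hId⟩
          exact hrel _ (e i).2 _ (e j).2 hne f g c₀ hW hId
        · -- the value: `∑ᵢ a(eᵢ) Ω(eᵢ) = ∑_{x ∈ support} a x · Ω x = E a = 0`
          have h1 : ∑ i : Fin k, (a (e i).1 : ℝ) * ω (e i).1 = ∑ x ∈ a.support, (a x : ℝ) * ω x := by
            rw [Equiv.sum_comp e (fun x => (a x.1 : ℝ) * ω x.1)]
            exact Finset.sum_coe_sort a.support (fun x => (a x : ℝ) * ω x)
          change ∑ i : Fin k, (a (e i).1 : ℝ) * ω (e i).1 = 0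
          rw [h1, ← hEsum, hEa]
  -- conclusion
  obtain ⟨a, ha, hπa, hEa⟩ := stepA c hc
  have hΨa : Ψ a = 0 := stepB _ a le_rfl ha (by rw [← hEa, hc0])
  have : π c = 0 := by rw [hπa, hΨa]
  rwa [hπ] at this

end Summit.KontsevichZagierPeriods.IsogenyCertificates.XMapKernelStubs.CellCollapse
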